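import Summits.CriticalPhenomena.CardyFormulaZ2.Theorems.CardyBoundaryCoulombGasBoundaryDefectGaussianRStubReferenceLimitPart3
import Literature.Probability.RandomPlanarGeometry.RectangleConformalMap
import Mathlib.Algebra.BigOperators.Group.Finset.Basic

/-!
# Stub `stub_referenceLimit` of line `rainbow-monomials-in-excursion-kernels` — Part 4:
# the reference marked domain and its APPROXIMABILITY (the non-vacuity half of the stub)

Crux `BoundaryDefectGaussianR` (stmt-CriticalPhenomena-14132). The registered stub asks, for every
leg family `(k, L, j)`, for ONE rectilinear marked domain `D₀` with flat marks, positively oriented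
at the sink, which is APPROXIMABLE (along every mesh sequence `δ_n → 0⁺` the lattice approximations
`V_n = {v : δ_n v ∈ closure D₀}` carry injective configurations `p_n → D₀.pt`, admissible from some
index on) and on which the Green-normalised rainbow functional has a LIMIT. The LIMIT conjunct is
the sharp asymptotics of boundary rainbow probabilities on `ℤ²` — open (triangular lattice:
Du–Gao–Li–Zhuang 2024) — and is NOT touched here. This file proves the other four conjuncts,
verbatim, for the square `D₀ = (-1, 1)²` (`rectDomain 1 1`) with the `k` marks `x_i - i`,
`x_i = 2(i+1)/(k+1) - 1`, on its open bottom side (parameters `(i+1)/(4(k+1))`), under the two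
hypotheses without which the stub is false (Part 5): a source exists (`∃ i ≠ j`) and source leg
numbers are positive; `rainbow_hyps_of_isAdmissible` extracts both from any admissible rainbow
datum (what `stub_transfer` has in hand). Configurations: `p_n i = (⌊x_i/δ_n⌋, -⌊1/δ_n⌋₊)` on the
bottom row of the box `V_n = [-A, A]²`, `A = ⌊1/δ_n⌋₊`, admissible by Part 3 once
`δ_n < (2/(k+1)) / (Σ L + 2)`.
-/

noncomputable section

namespace Summit.CriticalPhenomena.CardyFormulaZ2.Cruxes.BoundaryDefectGaussianR.RainbowMonomialsInExcursionKernels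

open Filter Topology Set
open Literature.Probability.RandomPlanarGeometry Literature.Probability.LatticeModels
  Literature.Probability.LatticeModels.CollarLegModel

/-! ### The unit square `(-1, 1)²` and its bottom side -/

/-- On `[0, 1/4]` the boundary loop of the square `rectDomain 1 1` runs along the bottom side,
left to right: `t ↦ (-1 + 8t) - i`. [folklore] -/
theorem polygonLoop_square_bottom {t : ℝ} (ht0 : 0 ≤ t) (ht : t ≤ 1 / 4) :
    polygonLoop (rectVerts 1 1) t = ⟨-1 + 8 * t, -1⟩ := by
  have h4 : 0 < (rectVerts (1 : ℝ) 1).length := by simp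
  have hθ : 4 * t ∈ Icc (0 : ℝ) 1 := ⟨by linarith, by linarith⟩
  have key := polygonLoop_apply_div h4 hθ
  have e : (((0 : ℕ) : ℝ) + 4 * t) / ((rectVerts (1 : ℝ) 1).length : ℝ) = t := by
    rw [length_rectVerts]; push_cast; ring
  rw [e] at key
  rw [key]
  apply Complex.ext
  · simp [rectVerts, AffineMap.lineMap_apply_module']; ring
  · simp [rectVerts, AffineMap.lineMap_apply_module']

/-- Near a point of the open bottom side, the frontier of the square is horizontal: a frontier
point within distance `min (1 - x) (1 + x)` of `x - i` (`-1 < x < 1`) has imaginary part `-1`. [folklore] -/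
theorem frontier_square_flat_bottom {x : ℝ} {z : ℂ}
    (hz : z ∈ frontier (symRect 1 1)) (hd : dist z ⟨x, -1⟩ < min (1 - x) (1 + x)) : z.im = -1 := by
  rw [mem_frontier_symRect one_pos one_pos] at hz
  have hre : |z.re - x| ≤ dist z ⟨x, -1⟩ := by
    rw [Complex.dist_eq]; simpa using Complex.abs_re_le_norm (z - ⟨x, -1⟩)
  have him : |z.im + 1| ≤ dist z ⟨x, -1⟩ := by
    rw [Complex.dist_eq]; simpa using Complex.abs_im_le_norm (z - ⟨x, -1⟩)
  have hd1 : dist z ⟨x, -1⟩ < 1 - x := lt_of_lt_of_le hd (min_le_left _ _)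
  have hd2 : dist z ⟨x, -1⟩ < 1 + x := lt_of_lt_of_le hd (min_le_right _ _)
  rcases hz with ⟨-, h | h⟩ | ⟨h | h, -⟩
  · exact h
  · exfalso; rw [h] at him; rw [abs_le] at hre; norm_num at him; linarith
  · exfalso; rw [h, abs_le] at hre; linarith [hre.1]
  · exfalso; rw [h, abs_le] at hre; linarith [hre.2]

/-- The frontier of the square lies on its four (axis-parallel) sides. [folklore] -/
theorem frontier_square_subset :
    frontier (symRect 1 1) ⊆ ⋃ q ∈ (Finset.univ.image fun k : Fin 4 =>
      (((rectVerts (1 : ℝ) 1)[(k : ℕ)]'(by simp [k.2]),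
        (rectVerts (1 : ℝ) 1)[((k : ℕ) + 1) % 4]'(by simp; omega)) : ℂ × ℂ)), segment ℝ q.1 q.2 := by
  intro z hz
  rw [← range_polygonLoop_rectVerts one_pos one_pos, range_polygonLoop (by simp [rectVerts])] at hz
  simp only [mem_iUnion] at hz
  obtain ⟨k, hk⟩ := hz
  simp only [mem_iUnion, Finset.mem_image, Finset.mem_univ, true_and, exists_prop]
  exact ⟨_, ⟨⟨k, by simp⟩, rfl⟩, hk⟩

/-- The four sides of the square are axis-parallel. [folklore] -/
theorem square_sides_axisParallel : ∀ q ∈ (Finset.univ.image fun k : Fin 4 =>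
      (((rectVerts (1 : ℝ) 1)[(k : ℕ)]'(by simp [k.2]),
        (rectVerts (1 : ℝ) 1)[((k : ℕ) + 1) % 4]'(by simp; omega)) : ℂ × ℂ)),
    q.1.re = q.2.re ∨ q.1.im = q.2.im := by
  intro q hq
  simp only [Finset.mem_image, Finset.mem_univ, true_and] at hq
  obtain ⟨k, rfl⟩ := hq
  fin_cases k <;> simp [rectVerts]

/-! ### Marks on the bottom side -/

/-- The boundary parameters of `k` evenly spaced marks on the bottom side. [folklore] -/
theorem square_mark_mem (k : ℕ) (i : Fin k) :
    ((i : ℝ) + 1) / (4 * (k + 1)) ∈ Ico (0 : ℝ) 1 := by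
  have hk : (0 : ℝ) < 4 * (k + 1) := by positivity
  have hi : (i : ℝ) + 1 ≤ k := by exact_mod_cast i.2
  refine ⟨div_nonneg (by positivity) hk.le, ?_⟩
  rw [div_lt_one hk]; linarith

/-- The marks are strictly increasing. [folklore] -/
theorem square_mark_strictMono (k : ℕ) : StrictMono fun i : Fin k => ((i : ℝ) + 1) / (4 * (k + 1)) := by
  intro i i' h
  have hk : (0 : ℝ) < 4 * (k + 1) := by positivity
  simp only
  rw [div_lt_div_iff_of_pos_right hk]
  have : (i : ℝ) < i' := by exact_mod_cast h
  linarith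

/-- The `i`-th marked point is `x_i - i` with `x_i = 2(i+1)/(k+1) - 1`. [folklore] -/
theorem polygonLoop_square_mark (k : ℕ) (i : Fin k) :
    polygonLoop (rectVerts 1 1) (((i : ℝ) + 1) / (4 * (k + 1))) = ⟨2 * ((i : ℝ) + 1) / (k + 1) - 1, -1⟩ := by
  have hk : (0 : ℝ) < k + 1 := by positivity
  have hi : (i : ℝ) + 1 ≤ k := by exact_mod_cast i.2
  rw [polygonLoop_square_bottom (by positivity)]
  · congr 1; field_simp; ring
  · rw [div_le_iff₀ (by positivity : (0 : ℝ) < 4 * (k + 1))]; linarith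

/-- The abscissa `x_i` of the `i`-th mark lies in `[-1 + 2/(k+1), 1 - 2/(k+1)]`. [folklore] -/
theorem square_mark_re_bounds (k : ℕ) (i : Fin k) :
    -1 + 2 / ((k : ℝ) + 1) ≤ 2 * ((i : ℝ) + 1) / (k + 1) - 1 ∧
      2 * ((i : ℝ) + 1) / (k + 1) - 1 ≤ 1 - 2 / ((k : ℝ) + 1) := by
  have hk : (0 : ℝ) < k + 1 := by positivity
  have hi : (i : ℝ) + 1 ≤ k := by exact_mod_cast i.2
  have hi0 : (0 : ℝ) ≤ i := by positivity
  constructor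
  · rw [mul_div_assoc]
    have : 2 / ((k : ℝ) + 1) ≤ 2 * (((i : ℝ) + 1) / (k + 1)) := by
      rw [div_le_iff₀ hk]
      have : 1 ≤ ((i : ℝ) + 1) / (k + 1) * (k + 1) := by rw [div_mul_cancel₀ _ hk.ne']; linarith
      linarith
    linarith
  · have : 2 * ((i : ℝ) + 1) / (k + 1) ≤ 2 - 2 / ((k : ℝ) + 1) := by
      rw [div_le_iff₀ hk, sub_mul, div_mul_cancel₀ _ hk.ne']
      linarith
    linarith

/-! ### Rounding to the lattice -/

/-- Rounding a real abscissa down to the lattice of mesh `δ` moves it by at most `δ`. [folklore] -/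
theorem floor_mul_mem (x : ℝ) {δ : ℝ} (hδ : 0 < δ) : x - δ ≤ (⌊x / δ⌋ : ℝ) * δ ∧ (⌊x / δ⌋ : ℝ) * δ ≤ x := by
  refine ⟨?_, by simpa [div_mul_cancel₀ _ hδ.ne'] using mul_le_mul_of_nonneg_right (Int.floor_le (x / δ)) hδ.le⟩
  have h := mul_le_mul_of_nonneg_right (Int.sub_one_lt_floor (x / δ)).le hδ.le
  rwa [sub_mul, div_mul_cancel₀ _ hδ.ne', one_mul] at h

/-- The lattice half-width `⌊1/δ⌋₊` of the square at mesh `δ`: `1 - δ ≤ ⌊1/δ⌋₊ δ ≤ 1`. [folklore] -/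
theorem natFloor_mul_mem {δ : ℝ} (hδ : 0 < δ) : 1 - δ ≤ (⌊1 / δ⌋₊ : ℝ) * δ ∧ (⌊1 / δ⌋₊ : ℝ) * δ ≤ 1 := by
  have h0 : (0 : ℝ) ≤ 1 / δ := by positivity
  refine ⟨?_, by have h := mul_le_mul_of_nonneg_right (Nat.floor_le h0) hδ.le; rwa [div_mul_cancel₀ _ hδ.ne'] at h⟩
  have h := mul_le_mul_of_nonneg_right (Nat.lt_floor_add_one (1 / δ)).le hδ.le
  rw [add_mul, div_mul_cancel₀ _ hδ.ne', one_mul] at h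
  linarith

/-- `δ ⌊x/δ_n⌋ → x` along any mesh sequence `δ_n → 0⁺`. [folklore] -/
theorem tendsto_floor_mul (x : ℝ) {δ : ℕ → ℝ} (hpos : ∀ n, 0 < δ n) (hδ : Tendsto δ atTop (𝓝 0)) :
    Tendsto (fun n => (⌊x / δ n⌋ : ℝ) * δ n) atTop (𝓝 x) := by
  refine tendsto_of_tendsto_of_tendsto_of_le_of_le (g := fun n => x - δ n) (h := fun _ => x) ?_
    tendsto_const_nhds (fun n => (floor_mul_mem x (hpos n)).1) (fun n => (floor_mul_mem x (hpos n)).2)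
  simpa using tendsto_const_nhds.sub hδ

/-- `δ_n ⌊1/δ_n⌋₊ → 1` along any mesh sequence `δ_n → 0⁺`. [folklore] -/
theorem tendsto_natFloor_mul {δ : ℕ → ℝ} (hpos : ∀ n, 0 < δ n) (hδ : Tendsto δ atTop (𝓝 0)) :
    Tendsto (fun n => (⌊1 / δ n⌋₊ : ℝ) * δ n) atTop (𝓝 1) := by
  refine tendsto_of_tendsto_of_tendsto_of_le_of_le (g := fun n => 1 - δ n) (h := fun _ => 1) ?_
    tendsto_const_nhds (fun n => (natFloor_mul_mem (hpos n)).1) (fun n => (natFloor_mul_mem (hpos n)).2)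
  simpa using tendsto_const_nhds.sub hδ

/-- From admissibility of a rainbow datum of an injective configuration: a source exists and all
source leg numbers are positive (the hypotheses of `referenceDomain_approximable`, as
`stub_transfer` can extract them from the crux's admissibility assumption). [folklore] -/
theorem rainbow_hyps_of_isAdmissible {k : ℕ} (L : Fin k → ℕ) (j : Fin k) (p : Fin k → ℤ × ℤ)
    (hp : Function.Injective p) {V : Finset (ℤ × ℤ)}
    (h : (⟨(Finset.univ.erase j).image p, fun v => ∑ b ∈ (Finset.univ.erase j).filter (fun b => p b = v), L b,
      p j⟩ : LegInsertionData).IsAdmissible V) : (∃ i, i ≠ j) ∧ ∀ i, i ≠ j → 1 ≤ L i := by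
  obtain ⟨⟨x, hx⟩, hlegs, -⟩ := h
  obtain ⟨i, hi, rfl⟩ := Finset.mem_image.1 hx
  refine ⟨⟨i, (Finset.mem_erase.1 hi).1⟩, fun i' hi' => ?_⟩
  have hm : i' ∈ Finset.univ.erase j := Finset.mem_erase.2 ⟨hi', Finset.mem_univ _⟩
  have hsum : ∑ b ∈ (Finset.univ.erase j).filter (fun b => p b = p i'), L b = L i' :=
    Finset.sum_eq_single_of_mem i' (Finset.mem_filter.2 ⟨hm, rfl⟩)
      (fun b hb hne => absurd (hp (Finset.mem_filter.1 hb).2) hne)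
  have := hlegs (p i') (Finset.mem_image_of_mem p hm)
  simp only at this
  rwa [hsum] at this

/-! ### The reference domain: the square with `k` marks on its bottom side -/

/-- **APPROXIMABILITY of the reference domain** (conjuncts RECTILINEAR, FLAT MARKS, ORIENTED AT
THE SINK and APPROXIMABLE of `stub_referenceLimit`, verbatim, for the square with `k` marks on
its bottom side), for every leg family with a source (`∃ i ≠ j`) and positive source leg numbers. [folklore] -/
theorem referenceDomain_approximable (k : ℕ) (L : Fin k → ℕ) (j : Fin k) (hk : ∃ i, i ≠ j)
    (hpos : ∀ i, i ≠ j → 1 ≤ L i) : ∃ D₀ :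
    Literature.Probability.RandomPlanarGeometry.MarkedDomain k, (∃ S : Finset (ℂ × ℂ), (∀ q ∈ S, q.1.re = q.2.re
    ∨ q.1.im = q.2.im) ∧ frontier D₀.carrier ⊆ ⋃ q ∈ S, segment ℝ q.1 q.2) ∧ (∀ i, (∃ r : ℝ, 0 < r ∧ ((∀ z ∈
    frontier D₀.carrier, dist z (D₀.pt i) < r → z.im = (D₀.pt i).im) ∨ (∀ z ∈ frontier D₀.carrier, dist z (D₀.pt
    i) < r → z.re = (D₀.pt i).re)))) ∧ (∃ τ : ℂ, ‖τ‖ = 1 ∧ (∃ ε : ℝ, 0 < ε ∧ ∀ t ∈ Set.Ioo (D₀.mark j) (D₀.mark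
    j + ε), ∃ s : ℝ, 0 < s ∧ D₀.boundary t = D₀.pt j + (s : ℂ) * τ) ∧ (∃ ε : ℝ, 0 < ε ∧ ∀ s ∈ Set.Ioo (0 : ℝ) ε,
    D₀.pt j + (s : ℂ) * (τ * Complex.I) ∈ D₀.carrier)) ∧ (∀ (δ : ℕ → ℝ), (∀ n, 0 < δ n) → Filter.Tendsto δ
    Filter.atTop (nhds 0) → ∀ (V : ℕ → Finset (ℤ × ℤ)), (∀ n, ∀ v : ℤ × ℤ, v ∈ V n ↔ (((v).1 : ℂ) * ((δ n : ℝ) :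
    ℂ) + ((v).2 : ℂ) * ((δ n : ℝ) : ℂ) * Complex.I) ∈ closure D₀.carrier) → ∃ p : ℕ → Fin k → ℤ × ℤ, (∀ n,
    Function.Injective ((p) n)) ∧ (∀ i, Filter.Tendsto (fun n ↦ ((((p) n i).1 : ℂ) * ((δ n : ℝ) : ℂ) + (((p) n
    i).2 : ℂ) * ((δ n : ℝ) : ℂ) * Complex.I)) Filter.atTop (nhds (D₀.pt i))) ∧ ∃ N : ℕ, ∀ n, N ≤ n →
    Literature.Probability.LatticeModels.CollarLegModel.LegInsertionData.IsAdmissible (⟨(Finset.univ.erase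
    j).image (p n), fun v ↦ ∑ b ∈ (Finset.univ.erase j).filter (fun b ↦ (p n) b = v), L b, (p n) j⟩ :
    Literature.Probability.LatticeModels.CollarLegModel.LegInsertionData) (V n)) := by
  classical
  -- the domain and its marked points
  let D₀ : MarkedDomain k := ⟨rectDomain 1 1 one_pos one_pos, fun i => ((i : ℝ) + 1) / (4 * (k + 1)),
    square_mark_strictMono k, square_mark_mem k⟩
  have hcar : D₀.carrier = symRect 1 1 := rfl
  have hbd : ∀ t, D₀.boundary t = polygonLoop (rectVerts 1 1) t := fun t => rfl
  have hmark : ∀ i, D₀.mark i = ((i : ℝ) + 1) / (4 * (k + 1)) := fun i => rfl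
  have hpt : ∀ i, D₀.pt i = ⟨2 * ((i : ℝ) + 1) / (k + 1) - 1, -1⟩ := fun i => polygonLoop_square_mark k i
  have hk0 : (0 : ℝ) < k + 1 := by positivity
  refine ⟨D₀, ⟨_, square_sides_axisParallel, hcar ▸ frontier_square_subset⟩, ?_, ?_, ?_⟩
  · -- FLAT MARKS: the frontier is horizontal near each mark
    intro i
    obtain ⟨hlo, hhi⟩ := square_mark_re_bounds k i
    have hg : (0 : ℝ) < 2 / ((k : ℝ) + 1) := by positivity
    refine ⟨min (1 - (2 * ((i : ℝ) + 1) / (k + 1) - 1)) (1 + (2 * ((i : ℝ) + 1) / (k + 1) - 1)),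
      lt_min (by linarith) (by linarith), Or.inl fun z hz hd => ?_⟩
    rw [hpt] at hd ⊢
    exact frontier_square_flat_bottom (hcar ▸ hz) hd
  · -- ORIENTED AT THE SINK: the bottom side runs in direction `τ = 1`, the interior is above it
    refine ⟨1, by simp, ⟨1 / (4 * ((k : ℝ) + 1)), by positivity, fun t ht => ?_⟩, ⟨1, one_pos, fun s hs => ?_⟩⟩
    · rw [hmark] at ht
      obtain ⟨ht1, ht2⟩ := ht
      have hj : (j : ℝ) + 1 ≤ k := by exact_mod_cast j.2
      have ht0 : 0 ≤ t := le_trans (by positivity) ht1.le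
      have ht4 : t ≤ 1 / 4 := by
        have : ((j : ℝ) + 1) / (4 * (k + 1)) + 1 / (4 * (k + 1)) ≤ 1 / 4 := by
          rw [← add_div, div_le_iff₀ (by positivity)]; linarith
        linarith
      refine ⟨8 * (t - ((j : ℝ) + 1) / (4 * (k + 1))), by linarith, ?_⟩
      rw [hbd, polygonLoop_square_bottom ht0 ht4, hpt]
      generalize hs₀ : (8 * (t - ((j : ℝ) + 1) / (4 * (k + 1))) : ℝ) = s₀
      apply Complex.ext
      · simp only [Complex.add_re, Complex.ofReal_re, mul_one]
        rw [← hs₀]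
        field_simp
        ring
      · simp only [Complex.add_im, Complex.mul_im, Complex.ofReal_re, Complex.one_im, Complex.ofReal_im,
          Complex.one_re, mul_zero, zero_mul, add_zero]
    · rw [hpt, hcar]
      obtain ⟨hlo, hhi⟩ := square_mark_re_bounds k j
      have hg : (0 : ℝ) < 2 / ((k : ℝ) + 1) := by positivity
      obtain ⟨hs0, hs1⟩ := hs
      have e : (⟨2 * ((j : ℝ) + 1) / (k + 1) - 1, -1⟩ : ℂ) + (s : ℂ) * (1 * Complex.I) =
          ⟨2 * ((j : ℝ) + 1) / (k + 1) - 1, -1 + s⟩ := by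
        apply Complex.ext <;> simp
      rw [e, mem_symRect]
      exact ⟨⟨by linarith, by linarith⟩, by linarith, by linarith⟩
  · -- APPROXIMABLE
    intro δ hδpos hδ V hV
    -- the gap between consecutive marks and a bound on all leg numbers
    set g : ℝ := 2 / ((k : ℝ) + 1) with hgdef
    set G : ℕ := (∑ i, L i) + 1 with hGdef
    have hg0 : 0 < g := by positivity
    have hG1 : 1 ≤ G := by omega
    obtain ⟨N, hN⟩ : ∃ N, ∀ n ≥ N, δ n < g / ((G : ℝ) + 1) :=
      eventually_atTop.1 (hδ.eventually (gt_mem_nhds (by positivity)))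
    have hkey : ∀ n, N ≤ n → (G : ℝ) + 1 ≤ g / δ n := fun n hn => by
      rw [le_div_iff₀ (hδpos n)]
      have := hN n hn
      rw [lt_div_iff₀ (by positivity)] at this
      linarith
    -- the abscissae of the marks and the lattice configurations
    have hxs : ∀ i : Fin k, -1 + g ≤ 2 * ((i : ℝ) + 1) / (k + 1) - 1 ∧ 2 * ((i : ℝ) + 1) / (k + 1) - 1 ≤ 1 - g :=
      square_mark_re_bounds k
    have hxgap : ∀ i i' : Fin k, i < i' →
        g ≤ (2 * ((i' : ℝ) + 1) / (k + 1) - 1) - (2 * ((i : ℝ) + 1) / (k + 1) - 1) := fun i i' h => by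
      have : (i : ℝ) + 1 ≤ i' := by exact_mod_cast h
      rw [hgdef, show (2 * ((i' : ℝ) + 1) / (k + 1) - 1) - (2 * ((i : ℝ) + 1) / (k + 1) - 1) =
        2 * ((i' : ℝ) - i) / (k + 1) by ring]
      exact div_le_div_of_nonneg_right (by linarith) hk0.le
    let p : ℕ → Fin k → ℤ × ℤ := fun n i =>
      if N ≤ n then (⌊(2 * ((i : ℝ) + 1) / (k + 1) - 1) / δ n⌋, -(⌊1 / δ n⌋₊ : ℤ)) else ((i : ℕ), 0)
    have hp : ∀ n, N ≤ n → ∀ i, p n i = (⌊(2 * ((i : ℝ) + 1) / (k + 1) - 1) / δ n⌋, -(⌊1 / δ n⌋₊ : ℤ)) :=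
      fun n hn i => if_pos hn
    -- separation, and distance to the corners, of the rounded marks
    have hsepℤ : ∀ n, N ≤ n → ∀ i i' : Fin k, i < i' →
        (G : ℤ) ≤ ⌊(2 * ((i' : ℝ) + 1) / (k + 1) - 1) / δ n⌋ - ⌊(2 * ((i : ℝ) + 1) / (k + 1) - 1) / δ n⌋ :=
      fun n hn i i' h => floor_sub_floor_ge (hδpos n) (hxgap i i' h) (hkey n hn)
    have hright : ∀ n, N ≤ n → ∀ i : Fin k, ⌊(2 * ((i : ℝ) + 1) / (k + 1) - 1) / δ n⌋ < (⌊1 / δ n⌋₊ : ℤ) :=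
      fun n hn i => floor_lt_natFloor (hδpos n) (hxs i).2 (by have := hkey n hn; linarith)
    have hleft : ∀ n, N ≤ n → ∀ i : Fin k, -(⌊1 / δ n⌋₊ : ℤ) < ⌊(2 * ((i : ℝ) + 1) / (k + 1) - 1) / δ n⌋ :=
      fun n hn i => neg_natFloor_lt_floor (hδpos n) (hxs i).1 (by
        have := hkey n hn
        have h1 : (1 : ℝ) ≤ G := by exact_mod_cast hG1
        linarith)
    have hinj' : ∀ n, N ≤ n → ∀ i i' : Fin k, p n i = p n i' → i = i' := by
      intro n hn i i' h
      rw [hp n hn, hp n hn] at h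
      have h1 := (Prod.ext_iff.1 h).1
      simp only at h1
      by_contra hne
      rcases lt_or_gt_of_ne hne with hlt | hlt
      · have := hsepℤ n hn i i' hlt; omega
      · have := hsepℤ n hn i' i hlt; omega
    refine ⟨p, fun n => ?_, fun i => ?_, N, fun n hn => ?_⟩
    · -- injectivity (for every `n`)
      intro i i' h
      by_cases hn : N ≤ n
      · exact hinj' n hn i i' h
      · simp only [p, if_neg hn, Prod.mk.injEq, Nat.cast_inj, and_true] at h
        exact Fin.ext h
    · -- convergence to the marked point
      have hlim : Tendsto (fun n => (((⌊(2 * ((i : ℝ) + 1) / (k + 1) - 1) / δ n⌋ : ℝ) * δ n : ℝ) : ℂ) +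
          ((-((⌊1 / δ n⌋₊ : ℝ) * δ n) : ℝ) : ℂ) * Complex.I) atTop (nhds (D₀.pt i)) := by
        rw [hpt, Complex.mk_eq_add_mul_I]
        refine ((Complex.continuous_ofReal.tendsto _).comp (tendsto_floor_mul _ hδpos hδ)).add
          (((Complex.continuous_ofReal.tendsto _).comp ?_).mul tendsto_const_nhds)
        simpa using (tendsto_natFloor_mul hδpos hδ).neg
      refine hlim.congr' ?_
      rw [EventuallyEq, eventually_atTop]
      refine ⟨N, fun n hn => ?_⟩
      rw [hp n hn]
      push_cast
      ring
    · -- admissibility from index `N` on: Part 3 on the box `[-A, A]²`, `A = ⌊1/δ_n⌋₊`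
      set A : ℕ := ⌊1 / δ n⌋₊ with hA
      have hA1 : 1 ≤ A := by
        rw [hA, Nat.one_le_floor_iff, le_div_iff₀ (hδpos n), one_mul]
        have h1 := hN n hn
        have h2 : g / ((G : ℝ) + 1) ≤ 1 := by
          rw [div_le_one (by positivity), hgdef]
          have : (2 : ℝ) / (k + 1) ≤ 2 := div_le_self (by norm_num) (by linarith)
          have : (1 : ℝ) ≤ G := by exact_mod_cast hG1
          linarith
        linarith
      have hAℤ : (⌊1 / δ n⌋ : ℤ) = (A : ℤ) := (Int.natCast_floor_eq_floor (one_div_nonneg.2 (hδpos n).le)).symm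
      have hbox : ∀ v : ℤ × ℤ, v ∈ V n ↔ (-(A : ℤ) ≤ v.1 ∧ v.1 ≤ -(A : ℤ) + ((2 * A : ℕ) : ℤ)) ∧
          (-(A : ℤ) ≤ v.2 ∧ v.2 ≤ -(A : ℤ) + ((2 * A : ℕ) : ℤ)) := by
        intro v
        rw [hV n v, hcar, mem_closure_symRect one_pos one_pos]
        have hre : (((v.1 : ℂ) * ((δ n : ℝ) : ℂ) + (v.2 : ℂ) * ((δ n : ℝ) : ℂ) * Complex.I)).re = v.1 * δ n := by
          simp
        have him : (((v.1 : ℂ) * ((δ n : ℝ) : ℂ) + (v.2 : ℂ) * ((δ n : ℝ) : ℂ) * Complex.I)).im = v.2 * δ n := by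
          simp
        rw [hre, him]
        have key : ∀ z : ℤ, (-1 ≤ (z : ℝ) * δ n ∧ (z : ℝ) * δ n ≤ 1) ↔
            (-(A : ℤ) ≤ z ∧ z ≤ -(A : ℤ) + ((2 * A : ℕ) : ℤ)) := by
          intro z
          have e1 : (-(A : ℤ) + ((2 * A : ℕ) : ℤ)) = ⌊1 / δ n⌋ := by rw [hAℤ]; push_cast; ring
          have e2 : (-(A : ℤ)) = -⌊1 / δ n⌋ := by rw [hAℤ]
          rw [e1, e2]
          have hz1 : (z : ℝ) * δ n ≤ 1 ↔ z ≤ ⌊1 / δ n⌋ := by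
            rw [Int.le_floor, le_div_iff₀ (hδpos n)]
          have hz2 : -1 ≤ (z : ℝ) * δ n ↔ -⌊1 / δ n⌋ ≤ z := by
            constructor
            · intro h
              have h' : ((-z : ℤ) : ℝ) ≤ 1 / δ n := by
                rw [le_div_iff₀ (hδpos n)]; push_cast; linarith
              have := Int.le_floor.2 h'
              omega
            · intro h
              have h' : (-z : ℤ) ≤ ⌊1 / δ n⌋ := by omega
              have := Int.le_floor.1 h'
              rw [le_div_iff₀ (hδpos n)] at this
              push_cast at this
              linarith
          rw [hz1, hz2]
        exact and_congr (key v.1) (key v.2)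
      have hmem : ∀ x ∈ insert (p n j) ((Finset.univ.erase j).image (p n)), ∃ i, x = p n i :=
        fun x hx => rainbow_mem_insert j (p n) hx
      refine isAdmissible_of_box hbox (by omega) _ (G := G) (rainbow_source_nonempty j (p n) hk)
        (rainbow_legs_pos L j (p n) hpos) (rainbow_sink_not_mem j (p n) fun i i' h => hinj' n hn i i' h)
        ((rainbow_sinkLegs_le L j (p n)).trans (Nat.le_succ _)) ?_ ?_
      · intro x hx
        obtain ⟨i, rfl⟩ := hmem x hx
        rw [hp n hn]
        have h1 := hleft n hn i
        have h2 := hright n hn i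
        refine ⟨rfl, h1, ?_⟩
        push_cast; omega
      · intro x hx x' hx' hne
        obtain ⟨i, rfl⟩ := hmem x hx
        obtain ⟨i', rfl⟩ := hmem x' hx'
        have hii : i ≠ i' := fun h => hne (h ▸ rfl)
        rw [hp n hn, hp n hn]
        simp only
        rcases lt_or_gt_of_ne hii with hlt | hlt
        · have := hsepℤ n hn i i' hlt
          rw [abs_sub_comm]; exact le_abs.2 (Or.inl this)
        · have := hsepℤ n hn i' i hlt
          exact le_abs.2 (Or.inl this)

/-- **Sub-goal `s4_referenceDomainApproximable` of stub 4** (registered on stmt-CriticalPhenomena-14132):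
the NON-VACUITY half of `stub_referenceLimit` — for every leg family with a source and positive
source leg numbers there is a rectilinear marked domain with flat marks, positively oriented at the
sink, which is APPROXIMABLE by admissible lattice data along every mesh sequence (the four conjuncts
verbatim; the square with marks on its bottom side, `referenceDomain_approximable`). The two
hypotheses are necessary: without a source, or with a leg number `0`, no rainbow datum is ever
admissible. The remaining LIMIT conjunct of the stub is the open sharp rainbow asymptotics on `ℤ²`. [folklore] -/
theorem s4_referenceDomainApproximable : ∀ (k : ℕ) (L : Fin k → ℕ) (j : Fin k), (∃ i, i ≠ j) → (∀ i, i ≠ j → 1 ≤ L i) → ∃ D₀ : Literature.Probability.RandomPlanarGeometry.MarkedDomain k, (∃ S : Finset (ℂ × ℂ), (∀ q ∈ S, q.1.re = q.2.re ∨ q.1.im = q.2.im) ∧ frontier D₀.carrier ⊆ ⋃ q ∈ S, segment ℝ q.1 q.2) ∧ (∀ i, (∃ r : ℝ, 0 < r ∧ ((∀ z ∈ frontier D₀.carrier, dist z (D₀.pt i) < r → z.im = (D₀.pt i).im) ∨ (∀ z ∈ frontier D₀.carrier, dist z (D₀.pt i) < r → z.re = (D₀.pt i).re)))) ∧ (∃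 τ : ℂ, ‖τ‖ = 1 ∧ (∃ ε : ℝ, 0 < ε ∧ ∀ t ∈ Set.Ioo (D₀.mark j) (D₀.mark j + ε), ∃ s : ℝ, 0 < s ∧ D₀.boundary t = D₀.pt j + (s : ℂ) * τ) ∧ (∃ ε : ℝ, 0 < ε ∧ ∀ s ∈ Set.Ioo (0 : ℝ) ε, D₀.pt j + (s : ℂ) * (τ * Complex.I) ∈ D₀.carrier)) ∧ (∀ (δ : ℕ → ℝ), (∀ n, 0 < δ n) → Filter.Tendsto δ Filter.atTop (nhds 0) → ∀ (V : ℕ → Finset (ℤ × ℤ)), (∀ n, ∀ v : ℤ × ℤ, v ∈ V n ↔ (((v).1 : ℂ) * ((δ n : ℝ) : ℂ) + ((v).2 : ℂ) * ((δ n : ℝ) : ℂ) * Complex.I) ∈ closure D₀.carrier) → ∃ p : ℕ → Fin k → ℤ × ℤ, (∀ n, Function.Injective ((p) n)) ∧ (∀ i, Filter.Tendsto (fun n ↦ ((((p) n i).1 : ℂ) * ((δ n : ℝ) : ℂ) + (((p) n i).2 : ℂ) * ((δ n : ℝ) : ℂ) * Complex.I)) Filter.atTop (nhds (D₀.pt i)))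 ∧ ∃ N : ℕ, ∀ n, N ≤ n → Literature.Probability.LatticeModels.CollarLegModel.LegInsertionData.IsAdmissible (⟨(Finset.univ.erase j).image (p n), fun v ↦ ∑ b ∈ (Finset.univ.erase j).filter (fun b ↦ (p n) b = v), L b, (p n) j⟩ : Literature.Probability.LatticeModels.CollarLegModel.LegInsertionData) (V n)) :=
  fun k L j hk hpos => referenceDomain_approximable k L j hk hpos

end Summit.CriticalPhenomena.CardyFormulaZ2.Cruxes.BoundaryDefectGaussianR.RainbowMonomialsInExcursionKernels

end
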